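import Summits.BirchSwinnertonDyer.BirchSwinnertonDyer.Theses.AdditiveBranchIMC
import Summits.BirchSwinnertonDyer.BirchSwinnertonDyer.Theorems.PublishedInputsGreenbergKummerImageHolds
import HarnessLib

set_option linter.dupNamespace false -- `…BirchSwinnertonDyer.BirchSwinnertonDyer…` is the cell's nested layout (D-0017)
set_option autoImplicit false

/-!
# Item 19305 `GreenbergKummerImageGoodOrdinary` (route `AdditiveBranchIMC`, support 903) — Greenberg LNM 1716 (1999)
# Props. 2.2 / 2.4: `Im(λ_K) ⊆ Im(κ_K)` at a good ordinary prime — PROVED BY NAME (LADDER-BSD D-0154 (2), INPUTS desk, by-name sweep)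

Seat `bsd-inputs-honda-p1` (gen 13, resident idle INPUTS prover of the desk `pub/bsd-wall/bsd-inputs`), `--workitem`
stmt-BirchSwinnertonDyer-19305. THEOREMS ONLY (no definition, no named fact, no `sorry`).

The item is the 1:1 alias of the named published fact
`Literature.NumberTheory.EllipticCurves.Greenberg1999.imKummer_ge_strictCondition_goodOrdinary` (A239: for a globally minimal elliptic `E/ℚ`, a
good ORDINARY prime `p`, the cyclotomic `ℤ_p`-extension, the place `v ∋ p`, any Greenberg datum whose `M⁺_v` is `C_v = ker(red₀)`, and any
closed finite-index `H ≤ ker κ`: the STRICT local condition at the place above `v` implies the Kummer condition — Greenberg, LNM 1716 (1999)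
§2 Prop. 2.4 with Prop. 2.2, pp. 73–75, typed over `ℚ` for `K = (F_∞)_η`, inclusion `⊇` only, weaker than print). That fact is a THEOREM of the
tree since 2026-08-28T14:48Z: `Summit.BirchSwinnertonDyer.BirchSwinnertonDyer.Theorems.InputsGreenbergKummerImage.imKummer_ge_strictCondition_goodOrdinary_holds`
(module `Theorems/PublishedInputsGreenbergKummerImageHolds.lean`, seat `bsd-inputs-k4-p1` g4, p642439, `--supports` 20309), the composition of
two kernel theorems —
* `Summit.BirchSwinnertonDyer.Rank1Residual.Additive.GoodModelLine.imKummer_ge_strictCondition_goodOrdinary_of_coatesGreenberg`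
  (cell `b2b-bsdres`: A239 from the Coates–Greenberg record `H1_goodModelKernel_trivial` through the good-model form S2/A249 and
  `Greenberg1999.imKummer_ge_strictCondition_goodOrdinary_of_goodOrdinaryModel`), and
* `Summit.BirchSwinnertonDyer.BirchSwinnertonDyer.Theorems.H1_goodModelKernel_trivial_holds` (cell `bsd-wall`: Coates–Greenberg 1996 Cor. 3.2
  with Thm. 2.13 for good models, universe `0`, from Tate's almost-étale computation `deeplyRamified_cyclotomicZpExtension_trace_holds`).
The route item (support 903 of `AdditiveBranchIMC`, HELD as a cited input) was never re-keyed to it; this leaf file records the discharge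
against the ROUTE declaration by `unfold; exact`, found by the desk's «open by-name alias whose fact has a `_holds`» sweep
(`pub/bsd-wall/bsd-inputs/bsd-inputs-honda-p1/sweep/`, 2026-08-28T14:50Z). Nothing is re-derived; no landed declaration is restated.

Honest framing: UNCONDITIONAL as typed (the two inputs are kernel theorems with the standard axioms). Closing item 19305 removes ONE displayed
print input of `AdditiveBranchIMC` AS TYPED (the typed fact is weaker than Greenberg's printed equality `Im(κ_K) = Im(λ_K)` over any number
field); the other seven children of the SPLIT pack `PrintedFacts` (19362) are unchanged; no crux and no summit statement is proved; the
Birch–Swinnerton-Dyer conjecture is NOT proved by any of this.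
References: [GreenbergLNM1716] §2 Prop. 2.4 and Prop. 2.2 (pp. 73–75), p. 83; [CoatesGreenberg1996] Cor. 3.2, Thm. 2.13; [Tate1967] §3.2 Prop. 9.
-/

namespace Summit.BirchSwinnertonDyer.BirchSwinnertonDyer.Theorems.InputsSweep

/-- **Item 19305 on route `AdditiveBranchIMC` — `GreenbergKummerImageGoodOrdinary` PROVED (by name):** Greenberg LNM 1716 §2 Prop. 2.4
(with Prop. 2.2): at a good ordinary prime of a globally minimal `E/ℚ`, along the cyclotomic `ℤ_p`-tower, the strict local condition implies
the Kummer condition (`Greenberg1999.imKummer_ge_strictCondition_goodOrdinary`, as typed), from the tree's discharge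
`InputsGreenbergKummerImage.imKummer_ge_strictCondition_goodOrdinary_holds` (Coates–Greenberg record `H1_goodModelKernel_trivial_holds` through
`GoodModelLine.imKummer_ge_strictCondition_goodOrdinary_of_coatesGreenberg`). Unconditional; closes item 19305; BSD is not proved by this.
[cite: GreenbergLNM1716, §2 Prop. 2.4 and the remark following its proof (pp. 74–75); Prop. 2.2 p. 73; p. 83]
[cite: CoatesGreenberg1996, Cor. 3.2 with Thm. 2.13] -/
theorem additiveBranchIMC_greenbergKummerImageGoodOrdinary_proof :
    Summit.BirchSwinnertonDyer.BirchSwinnertonDyer.Theses.AdditiveBranchIMC.GreenbergKummerImageGoodOrdinary := by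
  unfold Summit.BirchSwinnertonDyer.BirchSwinnertonDyer.Theses.AdditiveBranchIMC.GreenbergKummerImageGoodOrdinary
  exact Summit.BirchSwinnertonDyer.BirchSwinnertonDyer.Theorems.InputsGreenbergKummerImage.imKummer_ge_strictCondition_goodOrdinary_holds

end Summit.BirchSwinnertonDyer.BirchSwinnertonDyer.Theorems.InputsSweep
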